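import Summits.Langlands.Langlands.Theses.AdjointEulerNumerical
import Literature.FieldTheory.AlgClosed.PadicAlgClEquivComplex
import HarnessLib

/-!
# Line `prime-switch-redirect` — crux `Target` (stmt-Langlands-2174) of route AdjointEulerNumerical

Crux strategist planner-cstrat-stmt-Langlands-2174-r1-0 (2026-08-17; route re-audit bin RESTATED, BC2
redirect).  `Target` = "for every number field F ONE reciprocity datum Rec with, for all n ≥ 1,
(A) `AutomorphicToGalois n Rec hcpt` AND weak (B) (a.e. Satake–Frobenius automorphy of every
irreducible Rec-geometric ρ)".  It is summit-strength ((A) is carried verbatim; judge flag `smuggling`).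

THE LINE = THE DECOMPOSITION.  Five registered stubs, each VERBATIM a typed, separately staffed item of
the summit filed by route PrimeSwitchSplit (2026-08-17T01:56Z; three of them shared with route
CompatibleFamilySplit), and the kernel-checked composition `Target_of` (the prime-switch glue of that
route, conclusion weakened from `Langlands` to `Target`):

* `stub_weakGeometricAutomorphy`  = B_w (stmt-Langlands-17414): weak Fontaine–Mazur–Langlands, Rec-free;
* `stub_satakeAvatarExistence`    = W⁺  (stmt-Langlands-17415): irreducible Satake-level avatars;
* `stub_padicMemberCompatibility` = P   (stmt-Langlands-17534): de Rham + prime-switch principle at v ∣ ℓ;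
* `stub_compatibilityAwayFromL`   = L∤  (stmt-Langlands-17417): Taylor Conj. 7 at v ∤ ℓ, ∃ Rec form;
* `stub_avatarConjugacy`          = U   (stmt-Langlands-17844): uniqueness up to conjugacy (theorem-level).

`Target_of : B_w → W⁺ → P → L∤ → U → Target` — REAL proof, no sorry: fix F, Rec from L∤; helper: every
irreducible ρ Satake-compatible a.e. with an L-algebraic cuspidal π is Rec-geometric (unramified a.e.
from the Satake clause, de Rham = P(i)) and locally–globally compatible at EVERY finite v (v ∤ ℓ: L∤;
v ∣ ℓ: choose ℓ' ∈ {2,3} with ℓ' ∉ v, ι' : ℚ̄_ℓ' ≃ ℂ, an ℓ'-adic avatar ρ' from W⁺, its compatibility at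
v from L∤, switched to ρ by P(ii)); (A) = W⁺ + helper + U; weak (B) = B_w, because the p-adic Hodge
datum is PINNED (D-0018 L2: `ReciprocityData.pst` ignores Rec), so `IsGeometricFramed Rec ρ` is the
Rec-free hypothesis of B_w definitionally.  Every stub is used.

BC2 (c) probes (folder bc/*_probe.lean, lean check on the farm, 2026-08-17): for EACH stub statement C,
`C → Langlands` and `C → Target` FAIL under each of `exact?` / `simpa [C]` / `unfold C; simpa` / `aesop`
("exact? could not close the goal", "assumption failed" or heartbeat cap, "aesop: failed … after
exhaustive search"); the converses `Langlands → C`, `Target → C` also fail cheaply (record; `Langlands →`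
B_w, W⁺, P, L∤ is kernel-certified by PrimeSwitchSplit's SubsOfLanglands.lean, evidence on 17534).
No landed iff between any single piece and the summit (lean search: the names occur in no Theorems file).

Work the stubs AT THEIR ITEMS (17414/17415/17534/17417/17844), never here: this file only certifies the
glue.  Sorries: exactly the five `stub_*`.
-/

noncomputable section

set_option linter.dupNamespace false
set_option autoImplicit false

open scoped MatrixGroups Matrix Classical Polynomial NumberField
open Filter

namespace Summit.Langlands.Langlands.Cruxes.Target.PrimeSwitchRedirect

/-! ## The five piece statements (local abbreviations; bodies VERBATIM the PrimeSwitchSplit items) -/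

/-- B_w — verbatim the statement of item stmt-Langlands-17414 (`PrimeSwitchSplit.WeakGeometricAutomorphy`); open statement of the
summit, deliberately no citation tag. -/
def WeakGeometricAutomorphy : Prop :=
  ∀ (K : Type) [Field K] [NumberField K] (n : ℕ) (hcpt : Literature.NumberTheory.Automorphic.isCompact_glFiniteIntegralLevel n K), 0 < n → ∀ (ℓ : ℕ) [Fact ℓ.Prime] (ι : PadicAlgCl ℓ ≃+* ℂ) (ρ : Literature.NumberTheory.GaloisRepresentations.FramedGaloisRep K (PadicAlgCl ℓ) n), ρ.toGaloisRep.IsIrreducible → ((∀ᶠ v : IsDedekindDomain.HeightOneSpectrum (NumberField.RingOfIntegers K) in cofinite, ρ.IsUnramifiedAt v) ∧ ∀ (v : IsDedekindDomain.HeightOneSpectrum (NumberField.RingOfIntegers K)) (hv : ((ℓ : ℕ) : NumberField.RingOfIntegers K) ∈ v.asIdeal), (Literature.NumberTheory.PAdicHodge.fontainePstAdicCompletion v ℓ hv).IsDeRhamFramed (ρ.toLocal v)) → ∃ π : Literature.NumberTheory.Automorphic.CuspidalAutomorphicRepData n K hcpt, π.1.IsLAlgebraic ∧ ∀ᶠ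 v : IsDedekindDomain.HeightOneSpectrum (NumberField.RingOfIntegers K) in cofinite, SatakeFrobCompatibleAt ι π.1 ρ v

/-- W⁺ — verbatim the statement of item stmt-Langlands-17415 (`PrimeSwitchSplit.SatakeAvatarExistence`); open statement of the
summit, deliberately no citation tag. -/
def SatakeAvatarExistence : Prop :=
  ∀ (K : Type) [Field K] [NumberField K] (n : ℕ) (hcpt : Literature.NumberTheory.Automorphic.isCompact_glFiniteIntegralLevel n K), 0 < n → ∀ (π : Literature.NumberTheory.Automorphic.CuspidalAutomorphicRepData n K hcpt), π.1.IsLAlgebraic → ∀ (ℓ : ℕ) [Fact ℓ.Prime] (ι : PadicAlgCl ℓ ≃+* ℂ), ∃ ρ : Literature.NumberTheory.GaloisRepresentations.FramedGaloisRep K (PadicAlgCl ℓ) n, ρ.toGaloisRep.IsIrreducible ∧ ∀ᶠ v : IsDedekindDomain.HeightOneSpectrum (NumberField.RingOfIntegers K) in cofinite, SatakeFrobCompatibleAt ι π.1 ρ v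

/-- P — verbatim the statement of item stmt-Langlands-17534 (`PrimeSwitchSplit.PadicMemberCompatibility`); open statement of the
summit, deliberately no citation tag. -/
def PadicMemberCompatibility : Prop :=
  ∀ (K : Type) [Field K] [NumberField K] (n : ℕ) (hcpt : Literature.NumberTheory.Automorphic.isCompact_glFiniteIntegralLevel n K), 0 < n → ∀ (π : Literature.NumberTheory.Automorphic.CuspidalAutomorphicRepData n K hcpt), π.1.IsLAlgebraic → ∀ (ℓ : ℕ) [Fact ℓ.Prime] (ι : PadicAlgCl ℓ ≃+* ℂ) (ρ : Literature.NumberTheory.GaloisRepresentations.FramedGaloisRep K (PadicAlgCl ℓ) n), ρ.toGaloisRep.IsIrreducible → (∀ᶠ v : IsDedekindDomain.HeightOneSpectrum (NumberField.RingOfIntegers K) in cofinite, SatakeFrobCompatibleAt ι π.1 ρ v) → ∀ (v : IsDedekindDomain.HeightOneSpectrum (NumberField.RingOfIntegers K)) (hv : ((ℓ : ℕ) : NumberField.RingOfIntegers K) ∈ v.asIdeal), (Literature.NumberTheory.PAdicHodge.fontainePstAdicCompletion v ℓ hv).IsDeRhamFramed (ρ.toLocal v) ∧ ∀ (Rec :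 ReciprocityData K) (ℓ' : ℕ) [Fact ℓ'.Prime] (ι' : PadicAlgCl ℓ' ≃+* ℂ) (ρ' : Literature.NumberTheory.GaloisRepresentations.FramedGaloisRep K (PadicAlgCl ℓ') n), ((ℓ' : ℕ) : NumberField.RingOfIntegers K) ∉ v.asIdeal → ρ'.toGaloisRep.IsIrreducible → (∀ᶠ w : IsDedekindDomain.HeightOneSpectrum (NumberField.RingOfIntegers K) in cofinite, SatakeFrobCompatibleAt ι' π.1 ρ' w) → LocalGlobalCompatibleAt Rec ι' π.1 ρ' v → LocalGlobalCompatibleAt Rec ι π.1 ρ v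

/-- L∤ — verbatim the statement of item stmt-Langlands-17417 (`PrimeSwitchSplit.CompatibilityAwayFromL`); open statement of the
summit, deliberately no citation tag. -/
def CompatibilityAwayFromL : Prop :=
  ∀ (K : Type) [Field K] [NumberField K], ∃ Rec : ReciprocityData K, ∀ (n : ℕ) (hcpt : Literature.NumberTheory.Automorphic.isCompact_glFiniteIntegralLevel n K), 0 < n → ∀ (π : Literature.NumberTheory.Automorphic.CuspidalAutomorphicRepData n K hcpt), π.1.IsLAlgebraic → ∀ (ℓ : ℕ) [Fact ℓ.Prime] (ι : PadicAlgCl ℓ ≃+* ℂ) (ρ : Literature.NumberTheory.GaloisRepresentations.FramedGaloisRep K (PadicAlgCl ℓ) n), ρ.toGaloisRep.IsIrreducible → ((∀ᶠ v : IsDedekindDomain.HeightOneSpectrum (NumberField.RingOfIntegers K) in cofinite, ρ.IsUnramifiedAt v) ∧ ∀ (v : IsDedekindDomain.HeightOneSpectrum (NumberField.RingOfIntegers K)) (hv : ((ℓ : ℕ) : NumberField.RingOfIntegers K) ∈ v.asIdeal), (Literature.NumberTheory.PAdicHodge.fontainePstAdicCompletion v ℓ hv).IsDeRhamFramed (ρ.toLocal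 v)) → (∀ᶠ v : IsDedekindDomain.HeightOneSpectrum (NumberField.RingOfIntegers K) in cofinite, SatakeFrobCompatibleAt ι π.1 ρ v) → ∀ v : IsDedekindDomain.HeightOneSpectrum (NumberField.RingOfIntegers K), ((ℓ : ℕ) : NumberField.RingOfIntegers K) ∉ v.asIdeal → LocalGlobalCompatibleAt Rec ι π.1 ρ v

/-- U — verbatim the statement of item stmt-Langlands-17844 (`PrimeSwitchSplit.AvatarConjugacy`); open statement of the
summit, deliberately no citation tag. -/
def AvatarConjugacy : Prop :=
  ∀ (K : Type) [Field K] [NumberField K] (n : ℕ) (hcpt : Literature.NumberTheory.Automorphic.isCompact_glFiniteIntegralLevel n K) (π : Literature.NumberTheory.Automorphic.CuspidalAutomorphicRepData n K hcpt) (ℓ : ℕ) [Fact ℓ.Prime] (ι : PadicAlgCl ℓ ≃+* ℂ) (ρ₀ ρ : Literature.NumberTheory.GaloisRepresentations.FramedGaloisRep K (PadicAlgCl ℓ) n), ρ₀.toGaloisRep.IsIrreducible → (∀ᶠ v : IsDedekindDomain.HeightOneSpectrum (NumberField.RingOfIntegers K) in cofinite, SatakeFrobCompatibleAt ι π.1 ρ₀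 v) → (∀ᶠ v : IsDedekindDomain.HeightOneSpectrum (NumberField.RingOfIntegers K) in cofinite, SatakeFrobCompatibleAt ι π.1 ρ v) → IsConjugate ρ₀ ρ

/-! ## Registered stubs (one per piece; each is the shared ledger item named in its docstring) -/

/-- **STUB `stub_weakGeometricAutomorphy`** = B_w, item stmt-Langlands-17414 (work it there). -/
theorem stub_weakGeometricAutomorphy :
  ∀ (K : Type) [Field K] [NumberField K] (n : ℕ) (hcpt : Literature.NumberTheory.Automorphic.isCompact_glFiniteIntegralLevel n K), 0 < n → ∀ (ℓ : ℕ) [Fact ℓ.Prime] (ι : PadicAlgCl ℓ ≃+* ℂ) (ρ : Literature.NumberTheory.GaloisRepresentations.FramedGaloisRep K (PadicAlgCl ℓ) n), ρ.toGaloisRep.IsIrreducible → ((∀ᶠ v : IsDedekindDomain.HeightOneSpectrum (NumberField.RingOfIntegers K) in cofinite, ρ.IsUnramifiedAt v) ∧ ∀ (v : IsDedekindDomain.HeightOneSpectrum (NumberField.RingOfIntegers K)) (hv : ((ℓ : ℕ) : NumberField.RingOfIntegers K) ∈ v.asIdeal), (Literature.NumberTheory.PAdicHodge.fontainePstAdicCompletion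 v ℓ hv).IsDeRhamFramed (ρ.toLocal v)) → ∃ π : Literature.NumberTheory.Automorphic.CuspidalAutomorphicRepData n K hcpt, π.1.IsLAlgebraic ∧ ∀ᶠ v : IsDedekindDomain.HeightOneSpectrum (NumberField.RingOfIntegers K) in cofinite, SatakeFrobCompatibleAt ι π.1 ρ v := by
  sorry

/-- **STUB `stub_satakeAvatarExistence`** = W⁺, item stmt-Langlands-17415 (work it there). -/
theorem stub_satakeAvatarExistence :
  ∀ (K : Type) [Field K] [NumberField K] (n : ℕ) (hcpt : Literature.NumberTheory.Automorphic.isCompact_glFiniteIntegralLevel n K), 0 < n → ∀ (π : Literature.NumberTheory.Automorphic.CuspidalAutomorphicRepData n K hcpt), π.1.IsLAlgebraic → ∀ (ℓ : ℕ) [Fact ℓ.Prime] (ι : PadicAlgCl ℓ ≃+* ℂ), ∃ ρ : Literature.NumberTheory.GaloisRepresentations.FramedGaloisRep K (PadicAlgCl ℓ) n, ρ.toGaloisRep.IsIrreducible ∧ ∀ᶠ v : IsDedekindDomain.HeightOneSpectrum (NumberField.RingOfIntegers K) in cofinite, SatakeFrobCompatibleAt ι π.1 ρ v := by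
  sorry

/-- **STUB `stub_padicMemberCompatibility`** = P, item stmt-Langlands-17534 (work it there). -/
theorem stub_padicMemberCompatibility :
  ∀ (K : Type) [Field K] [NumberField K] (n : ℕ) (hcpt : Literature.NumberTheory.Automorphic.isCompact_glFiniteIntegralLevel n K), 0 < n → ∀ (π : Literature.NumberTheory.Automorphic.CuspidalAutomorphicRepData n K hcpt), π.1.IsLAlgebraic → ∀ (ℓ : ℕ) [Fact ℓ.Prime] (ι : PadicAlgCl ℓ ≃+* ℂ) (ρ : Literature.NumberTheory.GaloisRepresentations.FramedGaloisRep K (PadicAlgCl ℓ) n), ρ.toGaloisRep.IsIrreducible → (∀ᶠ v : IsDedekindDomain.HeightOneSpectrum (NumberField.RingOfIntegers K) in cofinite, SatakeFrobCompatibleAt ι π.1 ρ v) → ∀ (v : IsDedekindDomain.HeightOneSpectrum (NumberField.RingOfIntegers K)) (hv : ((ℓ : ℕ) : NumberField.RingOfIntegers K) ∈ v.asIdeal), (Literature.NumberTheory.PAdicHodge.fontainePstAdicCompletion v ℓ hv).IsDeRhamFramed (ρ.toLocal v) ∧ ∀ (Rec : ReciprocityData K) (ℓ' : ℕ) [Fact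 ℓ'.Prime] (ι' : PadicAlgCl ℓ' ≃+* ℂ) (ρ' : Literature.NumberTheory.GaloisRepresentations.FramedGaloisRep K (PadicAlgCl ℓ') n), ((ℓ' : ℕ) : NumberField.RingOfIntegers K) ∉ v.asIdeal → ρ'.toGaloisRep.IsIrreducible → (∀ᶠ w : IsDedekindDomain.HeightOneSpectrum (NumberField.RingOfIntegers K) in cofinite, SatakeFrobCompatibleAt ι' π.1 ρ' w) → LocalGlobalCompatibleAt Rec ι' π.1 ρ' v → LocalGlobalCompatibleAt Rec ι π.1 ρ v := by
  sorry

/-- **STUB `stub_compatibilityAwayFromL`** = L∤, item stmt-Langlands-17417 (work it there). -/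
theorem stub_compatibilityAwayFromL :
  ∀ (K : Type) [Field K] [NumberField K], ∃ Rec : ReciprocityData K, ∀ (n : ℕ) (hcpt : Literature.NumberTheory.Automorphic.isCompact_glFiniteIntegralLevel n K), 0 < n → ∀ (π : Literature.NumberTheory.Automorphic.CuspidalAutomorphicRepData n K hcpt), π.1.IsLAlgebraic → ∀ (ℓ : ℕ) [Fact ℓ.Prime] (ι : PadicAlgCl ℓ ≃+* ℂ) (ρ : Literature.NumberTheory.GaloisRepresentations.FramedGaloisRep K (PadicAlgCl ℓ) n), ρ.toGaloisRep.IsIrreducible → ((∀ᶠ v : IsDedekindDomain.HeightOneSpectrum (NumberField.RingOfIntegers K) in cofinite, ρ.IsUnramifiedAt v) ∧ ∀ (v : IsDedekindDomain.HeightOneSpectrum (NumberField.RingOfIntegers K)) (hv : ((ℓ : ℕ) : NumberField.RingOfIntegers K) ∈ v.asIdeal), (Literature.NumberTheory.PAdicHodge.fontainePstAdicCompletion v ℓ hv).IsDeRhamFramed (ρ.toLocal v)) → (∀ᶠ v : IsDedekindDomain.HeightOneSpectrum (NumberField.RingOfIntegers K) in cofinite, SatakeFrobCompatibleAt ι π.1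 ρ v) → ∀ v : IsDedekindDomain.HeightOneSpectrum (NumberField.RingOfIntegers K), ((ℓ : ℕ) : NumberField.RingOfIntegers K) ∉ v.asIdeal → LocalGlobalCompatibleAt Rec ι π.1 ρ v := by
  sorry

/-- **STUB `stub_avatarConjugacy`** = U, item stmt-Langlands-17844 (work it there). -/
theorem stub_avatarConjugacy :
  ∀ (K : Type) [Field K] [NumberField K] (n : ℕ) (hcpt : Literature.NumberTheory.Automorphic.isCompact_glFiniteIntegralLevel n K) (π : Literature.NumberTheory.Automorphic.CuspidalAutomorphicRepData n K hcpt) (ℓ : ℕ) [Fact ℓ.Prime] (ι : PadicAlgCl ℓ ≃+* ℂ) (ρ₀ ρ : Literature.NumberTheory.GaloisRepresentations.FramedGaloisRep K (PadicAlgCl ℓ) n), ρ₀.toGaloisRep.IsIrreducible → (∀ᶠ v : IsDedekindDomain.HeightOneSpectrum (NumberField.RingOfIntegers K) in cofinite, SatakeFrobCompatibleAt ι π.1 ρ₀ v) → (∀ᶠ v : IsDedekindDomain.HeightOneSpectrum (NumberField.RingOfIntegers K) in cofinite, SatakeFrobCompatibleAt ι π.1 ρ v) → IsConjugate ρ₀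 ρ := by
  sorry

/-! ## Composition (kernel-checked, no sorry outside `stub_*`): the stubs conclude the crux BY NAME -/

/-- **`Target_of`**: B_w → W⁺ → P → L∤ → U → `AdjointEulerNumerical.Target` (prime-switch glue).
[cite: BuzzardGeeLMS2014, Conj. 3.2.1 and Conj. 3.2.2] [cite: DeligneSerreASENS1974, Lemme 3.2] -/
theorem Target_of (hB : WeakGeometricAutomorphy) (hW : SatakeAvatarExistence)
    (hP : PadicMemberCompatibility) (hA : CompatibilityAwayFromL) (hU : AvatarConjugacy) :
    Summit.Langlands.Langlands.Theses.AdjointEulerNumerical.Target := by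
  intro F _ _
  obtain ⟨Rec, hRec⟩ := hA F
  -- every finite place misses the prime 2 or the prime 3
  have hprime : ∀ v : IsDedekindDomain.HeightOneSpectrum (NumberField.RingOfIntegers F),
      ∃ (ℓ' : ℕ) (_ : Fact ℓ'.Prime), ((ℓ' : ℕ) : NumberField.RingOfIntegers F) ∉ v.asIdeal := by
    intro v
    by_cases h2 : ((2 : ℕ) : NumberField.RingOfIntegers F) ∈ v.asIdeal
    · refine ⟨3, ⟨Nat.prime_three⟩, fun h3 => v.isPrime.ne_top ((Ideal.eq_top_iff_one _).2 ?_)⟩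
      have h := v.asIdeal.sub_mem h3 h2
      have h1 : ((3 : ℕ) : NumberField.RingOfIntegers F) - ((2 : ℕ) : NumberField.RingOfIntegers F) = 1 := by
        push_cast; norm_num
      rwa [h1] at h
    · exact ⟨2, ⟨Nat.prime_two⟩, h2⟩
  -- the local–global helper: geometric + compatible at EVERY finite place, for irreducible
  -- Satake–Frobenius compatible pairs; above ℓ the place is read through a prime below it
  have hLGC : ∀ (n : ℕ) (hcpt : Literature.NumberTheory.Automorphic.isCompact_glFiniteIntegralLevel n F),
      0 < n → ∀ (π : Literature.NumberTheory.Automorphic.CuspidalAutomorphicRepData n F hcpt), π.1.IsLAlgebraic →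
      ∀ (ℓ : ℕ) [Fact ℓ.Prime] (ι : PadicAlgCl ℓ ≃+* ℂ)
        (ρ : Literature.NumberTheory.GaloisRepresentations.FramedGaloisRep F (PadicAlgCl ℓ) n),
        ρ.toGaloisRep.IsIrreducible →
        (∀ᶠ v : IsDedekindDomain.HeightOneSpectrum (NumberField.RingOfIntegers F) in cofinite,
          SatakeFrobCompatibleAt ι π.1 ρ v) →
        IsGeometricFramed Rec ρ ∧
          ∀ v : IsDedekindDomain.HeightOneSpectrum (NumberField.RingOfIntegers F),
            LocalGlobalCompatibleAt Rec ι π.1 ρ v := by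
    intro n hcpt hn π hL ℓ _ ι ρ hirr hρ
    have hgeo : (∀ᶠ v : IsDedekindDomain.HeightOneSpectrum (NumberField.RingOfIntegers F) in cofinite,
        ρ.IsUnramifiedAt v) ∧
        ∀ (v : IsDedekindDomain.HeightOneSpectrum (NumberField.RingOfIntegers F))
          (hv : ((ℓ : ℕ) : NumberField.RingOfIntegers F) ∈ v.asIdeal),
          (Literature.NumberTheory.PAdicHodge.fontainePstAdicCompletion v ℓ hv).IsDeRhamFramed
            (ρ.toLocal v) :=
      ⟨hρ.mono fun v ⟨_, _, hur, _⟩ => hur, fun v hv => (hP F n hcpt hn π hL ℓ ι ρ hirr hρ v hv).1⟩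
    refine ⟨hgeo, fun v => ?_⟩
    by_cases hv : ((ℓ : ℕ) : NumberField.RingOfIntegers F) ∈ v.asIdeal
    · obtain ⟨ℓ', _, hℓ'⟩ := hprime v
      obtain ⟨ι'⟩ := PadicAlgCl.nonempty_ringEquiv_complex ℓ'
      obtain ⟨ρ', hirr', hρ'⟩ := hW F n hcpt hn π hL ℓ' ι'
      have hgeo' : (∀ᶠ w : IsDedekindDomain.HeightOneSpectrum (NumberField.RingOfIntegers F) in cofinite,
          ρ'.IsUnramifiedAt w) ∧
          ∀ (w : IsDedekindDomain.HeightOneSpectrum (NumberField.RingOfIntegers F))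
            (hw : ((ℓ' : ℕ) : NumberField.RingOfIntegers F) ∈ w.asIdeal),
            (Literature.NumberTheory.PAdicHodge.fontainePstAdicCompletion w ℓ' hw).IsDeRhamFramed
              (ρ'.toLocal w) :=
        ⟨hρ'.mono fun w ⟨_, _, hur, _⟩ => hur,
          fun w hw => (hP F n hcpt hn π hL ℓ' ι' ρ' hirr' hρ' w hw).1⟩
      -- the prime switch: compatibility with the ℓ'-adic avatar at v, moved to the ℓ-adic one by P(ii)
      exact (hP F n hcpt hn π hL ℓ ι ρ hirr hρ v hv).2 Rec ℓ' ι' ρ' hℓ' hirr' hρ'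
        (hRec n hcpt hn π hL ℓ' ι' ρ' hirr' hgeo' hρ' v hℓ')
    · exact hRec n hcpt hn π hL ℓ ι ρ hirr hgeo hρ v hv
  refine ⟨Rec, fun n hn hcpt => ⟨?_, ?_⟩⟩
  · -- (A) automorphic → Galois, with uniqueness up to conjugacy from U
    intro π hL ℓ _ ι
    obtain ⟨ρ, hirr, hρ⟩ := hW F n hcpt hn π hL ℓ ι
    obtain ⟨hgeo, hloc⟩ := hLGC n hcpt hn π hL ℓ ι ρ hirr hρ
    exact ⟨ρ, hirr, hgeo, ⟨hρ, hloc⟩, fun ρ' h' => hU F n hcpt π ℓ ι ρ ρ' hirr hρ h'.1⟩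
  · -- weak (B): the pinned datum makes `IsGeometricFramed Rec ρ` the Rec-free hypothesis of B_w
    intro ℓ _ ι ρ hirr hgeo
    exact hB F n hcpt hn ℓ ι ρ hirr ⟨hgeo.1, fun v hv => hgeo.2 v hv⟩

/-- The registered stubs literally compose to the crux (their statements are the bodies of the five
abbreviations, definitionally). -/
theorem Target_of_stubs : Summit.Langlands.Langlands.Theses.AdjointEulerNumerical.Target :=
  Target_of stub_weakGeometricAutomorphy stub_satakeAvatarExistence stub_padicMemberCompatibility
    stub_compatibilityAwayFromL stub_avatarConjugacy

end Summit.Langlands.Langlands.Cruxes.Target.PrimeSwitchRedirect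

end
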